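import Summits.AtomisticToContinuum.Crystallization.Theorems.FluxTubeKeplerFluxCellKeplerBlockPatterns

/-!
# `FluxCellKepler` (stmt-AtomisticToContinuum-15221), line `Sketch` — the periodic over-credit
# window and exactness of the local credit at the witness

Helper file of the lead prover (continuation c2) of crux `FluxTubeKepler.FluxCellKepler`
(`X = ∃ P₀ R₁ τ, Dom R₁ τ ∧ Kepler P₀ R₁ τ`).  For a periodic configuration `Q` of `ℝ³` and a
radius `R₁` let `bulkPat Q R₁ y` be the `R₁`-pattern of a point `y` of `Q` (relative positions of
the points of `Q` within `R₁`; it is what the crux's credit `τ` is fed at every site deep inside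
a large block of `Q`), `T_Q := Σ_{m ∈ F} τ (bulkPat Q R₁ m)` the credit of one period and
`S₆(Q) := Σ_{m ∈ F} Σ'_{q ≠ m} |q − m|⁻⁶` (`Blocks.sixSum Q`) the true `r⁻⁶` lattice sums of one
period.  Certified here, from tree facts only (block machinery of `ChargedEnergyGap/Negative`,
`witness_energy_eq_eStar`):

* `sixSum_le_bulkCredit` — (DOM alone) `S₆(Q) ≤ T_Q` for EVERY periodic `Q`: the local credit
  never under-credits the bulk of a periodic structure;
* `bulkCredit_le` — (DOM + KEPLER) for every `(δ, R, η)`, with the KEPLER constant `c`: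
  `T_Q ≤ S₆(Q) + 12·#F·(e(Q) − e⋆) − 12·c·motifBad R η Q` for every `δ`-separated periodic `Q`;
* `bulkCredit_window` — hence `0 ≤ T_Q − S₆(Q) ≤ 12·#F·(e(Q) − e⋆)` for every periodic `Q`
  (the OVER-CREDIT WINDOW: a local credit may over-credit the bulk of a periodic structure by at
  most twelve times its excess energy per period), and
* `bulkCredit_eq_of_minimiser`, `witness_exact` — EXACTNESS: `T_Q = S₆(Q)` for every periodic
  minimiser `Q` (`e(Q) = e⋆`), in particular for the witness `P₀` itself.

Consequences for the line (paper): the intended `q = 0` flux-cell credit is strictly positive on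
the hcp cell (`σ_h > 0`, jobs j026390) hence is NOT a witness credit if the minimiser is hcp-like;
any witness credit must be exact, on average over the motif, on every periodic minimiser, and its
over-credit on bcc / A15 / … is capped by `12 (e(Q) − e⋆)` per site.  `periodicPricing`
(`Negative/Pricing.lean`) is the statement that the window is non-empty.

Proof: run DOM and KEPLER on the blocks `blockConfig Q K`; the block `r⁻⁶` site energies are the
lattice sums minus tails that are `o(K³)` in sum (`exists_sum_tailSix_le`), the block `r⁻¹²` site
energies are at most the lattice sums, `(1/24)·S₁₂ = #F·e(Q) + (1/12)·S₆`; deep block sites are fed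
exactly their bulk pattern (`exists_eq_toP_of_dist_lt`), and the `O(K²)` non-deep sites are fed
patterns from a finite list independent of `K` (finite local complexity through lattice
coordinates, `abs_coords_sub_le`), on which `τ` is bounded; divide by `K³`.  All `[folklore]`.
-/

noncomputable section

namespace Summit.AtomisticToContinuum.Crystallization.Theorems.FluxCellKeplerSketchExact

open scoped BigOperators
open Literature.MathematicalPhysics.StatisticalMechanics
open Summit.AtomisticToContinuum.Crystallization.Theses.FluxTubeKepler
open Summit.AtomisticToContinuum.Crystallization.Theorems.ChargedEnergyGapNegative
open Summit.AtomisticToContinuum.Crystallization.Theorems.ChargedEnergyGapNegative.Blocks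
open Summit.AtomisticToContinuum.Crystallization.Theorems.FluxCellKepler

/-! ## The main inequalities -/

section Main

/-- Dividing by `K³`: if `K³ a ≤ K³ b + C K²` for all large `K` then `a ≤ b`. [folklore] -/
theorem le_of_cube_mul_le {a b C : ℝ} (K₀ : ℕ)
    (h : ∀ K : ℕ, K₀ ≤ K → (K : ℝ) ^ 3 * a ≤ (K : ℝ) ^ 3 * b + C * (K : ℝ) ^ 2) : a ≤ b := by
  refine le_of_forall_pos_le_add fun ε hε => ?_
  obtain ⟨K₁, hK₁⟩ := exists_nat_gt (C / ε)
  have hK := h (max K₀ (K₁ + 1)) (le_max_left _ _)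
  have hK1 : (K₁ : ℝ) + 1 ≤ (max K₀ (K₁ + 1) : ℕ) := by exact_mod_cast le_max_right K₀ (K₁ + 1)
  have hKpos : (0 : ℝ) < (max K₀ (K₁ + 1) : ℕ) := by
    linarith [(Nat.cast_nonneg K₁ : (0 : ℝ) ≤ K₁)]
  have hCK : C < ε * (max K₀ (K₁ + 1) : ℕ) := by
    rw [div_lt_iff₀ hε] at hK₁
    nlinarith
  have hK2 : (0 : ℝ) < ((max K₀ (K₁ + 1) : ℕ) : ℝ) ^ 2 := by positivity
  have hK3 : (0 : ℝ) < ((max K₀ (K₁ + 1) : ℕ) : ℝ) ^ 3 := by positivity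
  have h1 : C * ((max K₀ (K₁ + 1) : ℕ) : ℝ) ^ 2 ≤ ε * ((max K₀ (K₁ + 1) : ℕ) : ℝ) ^ 3 := by
    nlinarith
  have h2 : ((max K₀ (K₁ + 1) : ℕ) : ℝ) ^ 3 * a ≤ ((max K₀ (K₁ + 1) : ℕ) : ℝ) ^ 3 * (b + ε) := by
    nlinarith
  exact le_of_mul_le_mul_left h2 hK3

variable {P₀ : PeriodicConfiguration 3} {R₁ : ℝ} {τ : Finset E3 → ℝ}

/-- **(DOM alone) The local credit never under-credits the bulk of a periodic structure**:
`S₆(Q) ≤ T_Q = Σ_{m ∈ F} τ (bulkPat Q R₁ m)` for EVERY periodic configuration `Q`.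
[folklore] -/
theorem sixSum_le_bulkCredit (hD : Negative.Dom R₁ τ) (Q : PeriodicConfiguration 3) :
    sixSum Q ≤ bulkCredit Q R₁ τ := by
  classical
  obtain ⟨M, hM0, hM⟩ := exists_bound_tau_pat Q R₁ τ
  have hF : (0 : ℝ) < Q.motif.card := by exact_mod_cast Q.motif_nonempty.card_pos
  refine le_of_forall_pos_le_add fun ε hε => ?_
  obtain ⟨K₀, -, htail⟩ :=
    exists_sum_tailSix_le Q (show 0 < ε / (4 * Q.motif.card) by positivity)
  refine le_of_cube_mul_le K₀ (C := 6 * (depth Q (R₁ + 1)) * |bulkCredit Q R₁ τ| +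
    M * (Q.motif.card * (6 * (depth Q (R₁ + 1))))) fun K hK => ?_
  have hdom := hD _ (blockConfig Q K) (blockConfig_injective Q K)
  change ∑ i, siteEnergy (fun r => (r⁻¹) ^ 6) (blockConfig Q K) i ≤
    ∑ i, τ (pat R₁ (blockConfig Q K) i) at hdom
  rw [sum_siteEnergy_six_block, sum_tau_pat_block_eq] at hdom
  have hβ := abs_sum_boundary_le Q K R₁ τ hM0 hM
  have hdeepT := abs_card_deep_mul_sub_le K (depth Q (R₁ + 1)) (bulkCredit Q R₁ τ)
  have ht := htail K hK
  have heq : ε / (4 * Q.motif.card) * (2 * Q.motif.card * (K : ℝ) ^ 3) =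
      (K : ℝ) ^ 3 * (ε / 2) := by
    field_simp
    ring
  rw [heq] at ht
  rw [abs_le] at hβ hdeepT
  have hK3 : (0 : ℝ) ≤ (K : ℝ) ^ 3 * ε := by positivity
  linarith [hβ.1, hβ.2, hdeepT.1, hdeepT.2, ht, hdom, hK3]

/-- **(DOM + KEPLER) The over-credit on the bulk of a periodic structure is at most twelve times
its excess energy, minus the defect charge**: for every `(δ, R, η)`, with the KEPLER constant `c`,
`T_Q ≤ S₆(Q) + 12·#F·(e(Q) − e⋆) − 12·c·motifBad R η Q` for every `δ`-separated periodic `Q`.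
[folklore] -/
theorem bulkCredit_le (hD : Negative.Dom R₁ τ) (hK : Negative.Kepler P₀ R₁ τ) {δ R η : ℝ}
    (hδ : 0 < δ) (hR : 0 < R) (hη : 0 < η) :
    ∃ c : ℝ, 0 < c ∧ ∀ Q : PeriodicConfiguration 3,
      (∀ p ∈ Q.points, ∀ q ∈ Q.points, p ≠ q → δ ≤ dist p q) →
      bulkCredit Q R₁ τ ≤ sixSum Q +
        12 * Q.motif.card * (Q.energyPerParticle lennardJones - eStar) -
        12 * c * (Negative.motifBad R η Q : ℝ) := by
  classical
  obtain ⟨c, hc, hKc⟩ := hK δ hδ R η hR hη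
  have he := Negative.witness_energy_eq_eStar hD hK
  refine ⟨c, hc, fun Q hsep => ?_⟩
  obtain ⟨M, hM0, hM⟩ := exists_bound_tau_pat Q R₁ τ
  have hF : (0 : ℝ) < Q.motif.card := by exact_mod_cast Q.motif_nonempty.card_pos
  have hmB : (0 : ℝ) ≤ (Negative.motifBad R η Q : ℝ) := Nat.cast_nonneg _
  refine le_of_cube_mul_le 0 (C := 6 * (depth Q (R₁ + 1)) * |bulkCredit Q R₁ τ| +
    M * (Q.motif.card * (6 * (depth Q (R₁ + 1)))) +
    72 * c * (depth Q (R + 1)) * (Negative.motifBad R η Q : ℝ)) fun K _ => ?_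
  -- KEPLER on the block
  have hmem : ∀ i, blockConfig Q K i ∈ Q.points := fun i => by
    rw [blockConfig_apply]; exact bpt_mem Q K _
  have hsepx : ∀ i j, i ≠ j → δ ≤ dist (blockConfig Q K i) (blockConfig Q K j) :=
    fun i j hij => hsep _ (hmem i) _ (hmem j) ((blockConfig_injective Q K).ne hij)
  have hkep := hKc _ (blockConfig Q K) (blockConfig_injective Q K) hsepx
  change c * (Nat.card {i // ¬ Negative.Good R η (blockConfig Q K) i} : ℝ) ≤
    ∑ i, ((1 / 24 : ℝ) * siteEnergy (fun r => (r⁻¹) ^ 12) (blockConfig Q K) i -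
      (1 / 12 : ℝ) * τ (pat R₁ (blockConfig Q K) i)) -
      (Fintype.card (BIdx Q K) : ℝ) * P₀.energyPerParticle lennardJones at hkep
  rw [Finset.sum_sub_distrib, ← Finset.mul_sum, ← Finset.mul_sum, sum_tau_pat_block_eq,
    he] at hkep
  have hn : ((Fintype.card (BIdx Q K) : ℕ) : ℝ) = Q.motif.card * (K : ℝ) ^ 3 := by
    exact_mod_cast card_BIdx Q K
  rw [hn] at hkep
  -- the other ingredients
  have h12 := sum_siteEnergy_twelve_block_le Q K
  have hid := two_mul_card_mul_energyPerParticle Q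
  have hidK : (K : ℝ) ^ 3 * (2 * Q.motif.card * Q.energyPerParticle lennardJones) =
      (K : ℝ) ^ 3 * ((1 / 12 : ℝ) * twelveSum Q - (1 / 6 : ℝ) * sixSum Q) := by rw [hid]
  have hβ := abs_sum_boundary_le Q K R₁ τ hM0 hM
  have hdeepT := abs_card_deep_mul_sub_le K (depth Q (R₁ + 1)) (bulkCredit Q R₁ τ)
  rw [abs_le] at hβ hdeepT
  -- bad block sites: at least `#deep(d) · motifBad`
  let f : {k : Fin 3 → Fin K // IsDeep K (depth Q (R + 1)) k} ×
      {m : Q.motif // ¬ Negative.GoodRel R η (Negative.relSet Q m)} →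
      {i // ¬ Negative.Good R η (blockConfig Q K) i} := fun p =>
    ⟨Fintype.equivFin (BIdx Q K) (p.2.1, p.1.1), fun hg => p.2.2 (by
      have := Negative.goodRel_relSet_of_good Q K (u := (p.2.1, p.1.1)) p.1.2 hg
      rwa [bpt, Negative.relSet_add Q (latVec_mem Q _)] at this)⟩
  have hf : Function.Injective f := by
    rintro ⟨⟨k, hk⟩, ⟨m, hm⟩⟩ ⟨⟨k', hk'⟩, ⟨m', hm'⟩⟩ h
    have h' := congrArg (fun w => (Fintype.equivFin (BIdx Q K)).symm w.1) h
    simp only [f, Equiv.symm_apply_apply, Prod.mk.injEq] at h'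
    obtain ⟨rfl, rfl⟩ := h'
    rfl
  have hcard := Nat.card_le_card_of_injective f hf
  rw [Nat.card_prod] at hcard
  have hdeep := (card_deep_bounds K (depth Q (R + 1))).1
  have hbad : ((K : ℝ) ^ 3 - 6 * (depth Q (R + 1)) * (K : ℝ) ^ 2) * (Negative.motifBad R η Q : ℝ) ≤
      (Nat.card {i // ¬ Negative.Good R η (blockConfig Q K) i} : ℝ) := by
    have h2 : ((Nat.card {k : Fin 3 → Fin K // IsDeep K (depth Q (R + 1)) k} : ℕ) : ℝ) *
        (Negative.motifBad R η Q : ℝ) ≤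
        (Nat.card {i // ¬ Negative.Good R η (blockConfig Q K) i} : ℝ) := by
      unfold Negative.motifBad; exact_mod_cast hcard
    nlinarith
  have hbadc := mul_le_mul_of_nonneg_left hbad hc.le
  nlinarith [hkep, h12, hidK, hβ.1, hβ.2, hdeepT.1, hdeepT.2, hbadc, hmB, hc.le]

/-- **The over-credit window**: `0 ≤ T_Q − S₆(Q) ≤ 12·#F·(e(Q) − e⋆)` for every periodic `Q` and
every witness `(P₀, R₁, τ)` of the crux. [folklore] -/
theorem bulkCredit_window (hD : Negative.Dom R₁ τ) (hK : Negative.Kepler P₀ R₁ τ)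
    (Q : PeriodicConfiguration 3) :
    0 ≤ bulkCredit Q R₁ τ - sixSum Q ∧
      bulkCredit Q R₁ τ - sixSum Q ≤
        12 * Q.motif.card * (Q.energyPerParticle lennardJones - eStar) := by
  refine ⟨sub_nonneg.2 (sixSum_le_bulkCredit hD Q), ?_⟩
  obtain ⟨δ, hδ, hsep⟩ := Q.exists_pos_le_dist
  obtain ⟨c, hc, h⟩ := bulkCredit_le hD hK hδ one_pos one_pos
  have h1 := h Q hsep
  have h2 : (0 : ℝ) ≤ 12 * c * (Negative.motifBad 1 1 Q : ℝ) := by positivity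
  linarith

/-- **Exactness on periodic minimisers**: if `e(Q) = e⋆` then `T_Q = S₆(Q)`. [folklore] -/
theorem bulkCredit_eq_of_minimiser (hD : Negative.Dom R₁ τ) (hK : Negative.Kepler P₀ R₁ τ)
    {Q : PeriodicConfiguration 3} (hQ : Q.energyPerParticle lennardJones = eStar) :
    bulkCredit Q R₁ τ = sixSum Q := by
  obtain ⟨h1, h2⟩ := bulkCredit_window hD hK Q
  rw [hQ, sub_self, mul_zero] at h2
  linarith

/-- **Exactness at the witness**: for every witness `(P₀, R₁, τ)` of `FluxCellKepler`,
`Σ_{m ∈ F(P₀)} τ (bulkPat P₀ R₁ m) = Σ_{m ∈ F(P₀)} Σ'_{q ≠ m} |q − m|⁻⁶`: the local credit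
reproduces the `r⁻⁶` lattice sums of `P₀` exactly on average over the motif. [folklore] -/
theorem witness_exact (hD : Negative.Dom R₁ τ) (hK : Negative.Kepler P₀ R₁ τ) :
    bulkCredit P₀ R₁ τ = sixSum P₀ :=
  bulkCredit_eq_of_minimiser hD hK (Negative.witness_energy_eq_eStar hD hK)

/-- The same for the crux by name: `FluxCellKepler` has only witnesses whose credit is exact on
the witness configuration and over-credits every periodic `Q` by at most `12·#F·(e(Q) − e⋆)` per
period. [folklore] -/
theorem fluxCellKepler_witnesses_exact (h : FluxCellKepler) :
    ∃ (P₀ : PeriodicConfiguration 3) (R₁ : ℝ) (τ : Finset E3 → ℝ),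
      Negative.Dom R₁ τ ∧ Negative.Kepler P₀ R₁ τ ∧ bulkCredit P₀ R₁ τ = sixSum P₀ ∧
      ∀ Q : PeriodicConfiguration 3, sixSum Q ≤ bulkCredit Q R₁ τ ∧
        bulkCredit Q R₁ τ ≤ sixSum Q +
          12 * Q.motif.card * (Q.energyPerParticle lennardJones - eStar) := by
  obtain ⟨P₀, R₁, τ, hD, hK⟩ := Negative.fluxCellKepler_iff.1 h
  refine ⟨P₀, R₁, τ, hD, hK, witness_exact hD hK, fun Q => ⟨sixSum_le_bulkCredit hD Q, ?_⟩⟩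
  have := (bulkCredit_window hD hK Q).2
  linarith

end Main

end Summit.AtomisticToContinuum.Crystallization.Theorems.FluxCellKeplerSketchExact

end
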